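import Summits.Ventures.PercRepro.S2MaxExtensionCount

/-!
# PercRepro — S2: THE MAXIMAL-CLOSURE COUNT WITH ONE DISTINGUISHED FLAT (p7, gen 13; sub-claim S2; the cell `(14, 8)`)

S2MaxExtensionPairs / S2MaxExtensionCount with TWO levels of the maximal-extension bound: a distinguished rank-`4` flat `G ⊆ E` with `≤ E`
maximal extensions, every other rank-`4` flat with `≥ 5` points with `≤ e ≤ E`. The fibres through `G` are counted by the points of `G`:
through a `4`-circuit `C` at most `|G|` of the points `x` have `cl(C ∪ x) = G`, through a triangle at most `|G|² − |G|` ordered pairs have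
`cl(C ∪ {x, y}) = G`, and at most `C(|G|, 5)` `5`-circuits lie in `G`. **`card_spanMax_mul_six_le_two`**:
`6·#{S ∈ spanAll : |cl S| = f} ≤ s₃·(((n − 3)² − (n − 3))·e + (|G|² − |G|)·(E − e)) + s₄·3·((n − 4)·e + |G|·(E − e)) + s₅·6e + C(|G|, 5)·6(E − e) + 6s₆`.
At `(14, 8)`, `ν = 5`, with `G` the (unique) `9`-point rank-`4` flat: `E = 13`, `e = 8`, against the uniform `e = 13`. Axioms: standard.
-/

open scoped Matroid

namespace PercRepro

namespace S2

open Set Finset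

variable {α : Type} {M : Matroid α}

open scoped Classical in
/-- **`4`-circuits, two levels**: `2·#extMax C 2 f ≤ |E ∖ C|·e + |G|·(E − e)`. -/
theorem card_extMax_two_mul_le_two [M.Finite] {C : Set α} (hCE : C ⊆ M.E) (hCr : M.eRk C = 3) (hC4 : 4 ≤ C.ncard)
    (f e E : ℕ) (heE : e ≤ E) {G : Set α} (hGE : G ⊆ M.E)
    (hG : ({x ∈ M.E \ G | (M.closure (insert x G)).ncard = f}).ncard ≤ E)
    (he : ∀ P ⊆ M.E, M.closure P = P → M.eRk P = 4 → 5 ≤ P.ncard → P ≠ G →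
      ({x ∈ M.E \ P | (M.closure (insert x P)).ncard = f}).ncard ≤ e) :
    ((Matroid.subsF (Matroid.groundF M) 2).filter (fun B' => Disjoint B' C ∧ M.eRk (C ∪ B') = 5 ∧ (M.closure (C ∪ B')).ncard = f)).card * 2 ≤
      (M.E \ C).ncard * e + G.ncard * (E - e) := by
  have hECfin : (M.E \ C).Finite := M.ground_finite.subset Set.sdiff_subset
  have hGfin : G.Finite := M.ground_finite.subset hGE
  set s := (Matroid.subsF (Matroid.groundF M) 2).filter (fun B' => Disjoint B' C ∧ M.eRk (C ∪ B') = 5 ∧ (M.closure (C ∪ B')).ncard = f) with hs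
  set t : Finset α := hECfin.toFinset with htdef
  have hmemt : ∀ x, x ∈ t ↔ x ∈ M.E ∧ x ∉ C := fun x => by
    rw [htdef, Set.Finite.mem_toFinset, Set.mem_sdiff]
  set r : Set α → α → Prop := fun B' x => x ∈ B' with hr
  -- the double count as a sum
  have hsum := Finset.sum_card_bipartiteAbove_eq_sum_card_bipartiteBelow (s := s) (t := t) (r := r)
  have hleft : ∑ B' ∈ s, (t.bipartiteAbove r B').card = s.card * 2 := by
    rw [Finset.card_eq_sum_ones, Finset.sum_mul]
    refine Finset.sum_congr rfl (fun B' hB' => ?_)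
    rw [one_mul]
    obtain ⟨⟨hB'E, hB'2⟩, hdis, -, -⟩ := mem_extMax.1 hB'
    obtain ⟨a, b, hab, rfl⟩ := Set.ncard_eq_two.1 hB'2
    have ha : a ∈ t := (hmemt a).2 ⟨hB'E (Set.mem_insert a {b}), Set.disjoint_left.1 hdis (Set.mem_insert a {b})⟩
    have hb : b ∈ t := (hmemt b).2 ⟨hB'E (Set.mem_insert_of_mem a rfl), Set.disjoint_left.1 hdis (Set.mem_insert_of_mem a rfl)⟩
    have : t.bipartiteAbove r {a, b} = {a, b} := by
      ext z
      rw [Finset.mem_bipartiteAbove, Finset.mem_insert, Finset.mem_singleton]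
      constructor
      · rintro ⟨-, hz⟩
        rcases hz with rfl | hz
        · exact Or.inl rfl
        · exact Or.inr (Set.mem_singleton_iff.1 hz)
      · rintro (rfl | rfl)
        · exact ⟨ha, Set.mem_insert z {b}⟩
        · exact ⟨hb, Set.mem_insert_of_mem a rfl⟩
    rw [Finset.card_eq_two]
    exact ⟨a, b, hab, by convert this⟩
  -- the fibre of `x`: `≤ e`, or `≤ E` when `cl(C ∪ x) = G`
  have hright : ∀ x ∈ t, (s.bipartiteBelow r x).card ≤ e + (if M.closure (insert x C) = G then E - e else 0) := by
    intro x hx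
    obtain ⟨hxE, hxC⟩ := (hmemt x).1 hx
    by_cases hxcl : x ∈ M.closure C
    · have : s.bipartiteBelow r x = ∅ := by
        rw [Finset.eq_empty_iff_forall_notMem]
        intro B' hB'
        rw [Finset.mem_bipartiteBelow] at hB'
        obtain ⟨hB'mem, hxB'⟩ := hB'
        obtain ⟨⟨hB'E, hB'2⟩, hdis, hr, -⟩ := mem_extMax.1 hB'mem
        obtain ⟨y, hyx, rfl⟩ := exists_eq_pair_of_ncard_eq_two hB'2 hxB'
        have hunion : C ∪ ({x, y} : Set α) = insert x (insert y C) := by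
          ext z; simp only [Set.mem_union, Set.mem_insert_iff, Set.mem_singleton_iff]; tauto
        have hxcl' : x ∈ M.closure (insert y C) := M.closure_subset_closure (Set.subset_insert y C) hxcl
        rw [hunion, eRk_insert_eq_of_mem_closure hxcl'] at hr
        have h1 : M.eRk (insert y C) ≤ M.eRk C + 1 := M.eRk_insert_le_add_one _ _
        rw [hr, hCr] at h1
        norm_num at h1
      rw [this, Finset.card_empty]
      exact Nat.zero_le _
    · set P : Set α := M.closure (insert x C) with hPdef
      have hPE : P ⊆ M.E := M.closure_subset_ground _
      have hPflat : M.closure P = P := M.closure_closure _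
      have hPr : M.eRk P = 4 := by
        rw [hPdef, M.eRk_closure_eq, M.eRk_insert_eq_add_one ⟨hxE, hxcl⟩, hCr]
        norm_num
      have hP5 : 5 ≤ P.ncard := by
        have h1 : (insert x C).ncard = C.ncard + 1 :=
          Set.ncard_insert_of_notMem hxC (M.ground_finite.subset hCE)
        have h2 : (insert x C).ncard ≤ P.ncard :=
          Set.ncard_le_ncard (M.subset_closure _ (Set.insert_subset hxE hCE)) (M.ground_finite.subset hPE)
        omega
      have hfin : ({x ∈ M.E \ P | (M.closure (insert x P)).ncard = f}).Finite :=
        M.ground_finite.subset (maxExt_subset_ground _ f)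
      have hfibre : (s.bipartiteBelow r x).card ≤ ({x ∈ M.E \ P | (M.closure (insert x P)).ncard = f}).ncard := by
        rw [Set.ncard_eq_toFinset_card _ hfin]
        refine (Finset.card_le_card (?_ : _ ⊆ hfin.toFinset.image (fun y => ({x, y} : Set α)))).trans
          Finset.card_image_le
        intro B' hB'
        rw [Finset.mem_bipartiteBelow] at hB'
        obtain ⟨hB'mem, hxB'⟩ := hB'
        obtain ⟨⟨hB'E, hB'2⟩, hdis, hr, hcl⟩ := mem_extMax.1 hB'mem
        obtain ⟨y, hyx, rfl⟩ := exists_eq_pair_of_ncard_eq_two hB'2 hxB'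
        rw [Finset.mem_image]
        refine ⟨y, ?_, rfl⟩
        rw [Set.Finite.mem_toFinset, mem_maxExt]
        have hyE : y ∈ M.E := hB'E (Set.mem_insert_of_mem x rfl)
        have hunion : C ∪ ({x, y} : Set α) = insert y (insert x C) := by
          ext z; simp only [Set.mem_union, Set.mem_insert_iff, Set.mem_singleton_iff]; tauto
        have hyP : y ∉ P := by
          intro hyP
          rw [hunion, eRk_insert_eq_of_mem_closure hyP, M.eRk_insert_eq_add_one ⟨hxE, hxcl⟩, hCr] at hr
          norm_num at hr
        refine ⟨hyE, hyP, ?_⟩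
        rw [hPdef, M.closure_insert_closure_eq_closure_insert, ← hunion]
        exact hcl
      by_cases hPG : P = G
      · rw [if_pos hPG]
        refine hfibre.trans ?_
        rw [hPG]
        omega
      · rw [if_neg hPG, add_zero]
        exact hfibre.trans (he P hPE hPflat hPr hP5 hPG)
  -- the `G`-fibres: at most `|G|` points `x`
  have hGcount : (t.filter (fun x => M.closure (insert x C) = G)).card ≤ G.ncard := by
    rw [Set.ncard_eq_toFinset_card _ hGfin]
    refine Finset.card_le_card ?_
    intro x hx
    rw [Finset.mem_filter] at hx
    rw [Set.Finite.mem_toFinset, ← hx.2]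
    exact M.mem_closure_of_mem' (Set.mem_insert x C) ((hmemt x).1 hx.1).1
  calc s.card * 2 = ∑ B' ∈ s, (t.bipartiteAbove r B').card := hleft.symm
    _ = ∑ x ∈ t, (s.bipartiteBelow r x).card := hsum
    _ ≤ ∑ x ∈ t, (e + (if M.closure (insert x C) = G then E - e else 0)) := Finset.sum_le_sum hright
    _ = t.card * e + (t.filter (fun x => M.closure (insert x C) = G)).card * (E - e) := by
        rw [Finset.sum_add_distrib, Finset.sum_const, smul_eq_mul, Finset.sum_ite, Finset.sum_const_zero, add_zero,
          Finset.sum_const, smul_eq_mul]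
    _ ≤ (M.E \ C).ncard * e + G.ncard * (E - e) := by
        rw [Set.ncard_eq_toFinset_card _ hECfin]
        exact add_le_add le_rfl (Nat.mul_le_mul_right _ hGcount)

open scoped Classical in
/-- **Triangles, two levels**: `6·#extMax C 3 f ≤ (|E ∖ C|² − |E ∖ C|)·e + (|G|² − |G|)·(E − e)`. -/
theorem card_extMax_three_mul_le_two [M.Finite] {C : Set α} (hCE : C ⊆ M.E) (hCr : M.eRk C = 2) (hC3 : C.ncard = 3)
    (f e E : ℕ) (heE : e ≤ E) {G : Set α} (hGE : G ⊆ M.E)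
    (hG : ({x ∈ M.E \ G | (M.closure (insert x G)).ncard = f}).ncard ≤ E)
    (he : ∀ P ⊆ M.E, M.closure P = P → M.eRk P = 4 → 5 ≤ P.ncard → P ≠ G →
      ({x ∈ M.E \ P | (M.closure (insert x P)).ncard = f}).ncard ≤ e) :
    ((Matroid.subsF (Matroid.groundF M) 3).filter (fun B' => Disjoint B' C ∧ M.eRk (C ∪ B') = 5 ∧ (M.closure (C ∪ B')).ncard = f)).card * 6 ≤
      ((M.E \ C).ncard * (M.E \ C).ncard - (M.E \ C).ncard) * e + (G.ncard * G.ncard - G.ncard) * (E - e) := by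
  have hECfin : (M.E \ C).Finite := M.ground_finite.subset Set.sdiff_subset
  have hGfin : G.Finite := M.ground_finite.subset hGE
  set s := (Matroid.subsF (Matroid.groundF M) 3).filter (fun B' => Disjoint B' C ∧ M.eRk (C ∪ B') = 5 ∧ (M.closure (C ∪ B')).ncard = f) with hs
  set t : Finset (α × α) := hECfin.toFinset.offDiag with htdef
  have hmemt : ∀ x, x ∈ hECfin.toFinset ↔ x ∈ M.E ∧ x ∉ C := fun x => by
    rw [Set.Finite.mem_toFinset, Set.mem_sdiff]
  set r : Set α → α × α → Prop := fun B' xy => xy.1 ∈ B' ∧ xy.2 ∈ B' with hr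
  have hsum := Finset.sum_card_bipartiteAbove_eq_sum_card_bipartiteBelow (s := s) (t := t) (r := r)
  have hleft : ∑ B' ∈ s, (t.bipartiteAbove r B').card = s.card * 6 := by
    rw [Finset.card_eq_sum_ones, Finset.sum_mul]
    refine Finset.sum_congr rfl (fun B' hB' => ?_)
    rw [one_mul]
    obtain ⟨⟨hB'E, hB'3⟩, hdis, -, -⟩ := mem_extMax.1 hB'
    have hB'fin : B'.Finite := M.ground_finite.subset hB'E
    have hsub : hB'fin.toFinset ⊆ hECfin.toFinset := by
      intro z hz
      rw [Set.Finite.mem_toFinset] at hz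
      exact (hmemt z).2 ⟨hB'E hz, Set.disjoint_left.1 hdis hz⟩
    have hcard : hB'fin.toFinset.card = 3 := by rw [← Set.ncard_eq_toFinset_card _ hB'fin]; exact hB'3
    have : t.bipartiteAbove r B' = hB'fin.toFinset.offDiag := by
      ext xy
      simp only [Finset.mem_bipartiteAbove, Finset.mem_offDiag, htdef, hr, Set.Finite.mem_toFinset, Set.mem_sdiff]
      constructor
      · rintro ⟨⟨-, -, h3⟩, h1, h2⟩
        exact ⟨h1, h2, h3⟩
      · rintro ⟨h1, h2, h3⟩
        exact ⟨⟨⟨hB'E h1, Set.disjoint_left.1 hdis h1⟩, ⟨hB'E h2, Set.disjoint_left.1 hdis h2⟩, h3⟩, h1, h2⟩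
    rw [show (t.bipartiteAbove r B').card = hB'fin.toFinset.offDiag.card by rw [this], Finset.offDiag_card, hcard]
  have hright : ∀ xy ∈ t, (s.bipartiteBelow r xy).card ≤
      e + (if M.closure (insert xy.2 (insert xy.1 C)) = G then E - e else 0) := by
    rintro ⟨x, y⟩ hxy
    rw [htdef, Finset.mem_offDiag] at hxy
    obtain ⟨hx, hy, hxy⟩ := hxy
    obtain ⟨hxE, hxC⟩ := (hmemt x).1 hx
    obtain ⟨hyE, hyC⟩ := (hmemt y).1 hy
    simp only at hxy ⊢
    set Q : Set α := insert y (insert x C) with hQdef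
    have hQE : Q ⊆ M.E := Set.insert_subset hyE (Set.insert_subset hxE hCE)
    have hfibre : ∀ B' ∈ s.bipartiteBelow r (x, y),
        ∃ z, z ≠ x ∧ z ≠ y ∧ B' = {x, y} ∪ {z} ∧ C ∪ B' = insert z Q := by
      intro B' hB'
      rw [Finset.mem_bipartiteBelow] at hB'
      obtain ⟨hB'mem, hxB', hyB'⟩ := hB'
      obtain ⟨⟨-, hB'3⟩, -, -, -⟩ := mem_extMax.1 hB'mem
      obtain ⟨z, hzx, hzy, hB'⟩ := exists_eq_of_ncard_eq_three hB'3 hxB' hyB' hxy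
      refine ⟨z, hzx, hzy, hB', ?_⟩
      rw [hB', hQdef]
      ext w; simp only [Set.mem_union, Set.mem_insert_iff, Set.mem_singleton_iff]; tauto
    by_cases hQr : M.eRk Q = 4
    · set P : Set α := M.closure Q with hPdef
      have hPE : P ⊆ M.E := M.closure_subset_ground _
      have hPflat : M.closure P = P := M.closure_closure _
      have hPr : M.eRk P = 4 := by rw [hPdef, M.eRk_closure_eq, hQr]
      have hP5 : 5 ≤ P.ncard := by
        have h1 : Q.ncard = 5 := by
          rw [hQdef, Set.ncard_insert_of_notMem (by
            intro h; rcases h with h | h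
            · exact hxy h.symm
            · exact hyC h) (M.ground_finite.subset (Set.insert_subset hxE hCE)),
            Set.ncard_insert_of_notMem hxC (M.ground_finite.subset hCE), hC3]
        have h2 : Q.ncard ≤ P.ncard := Set.ncard_le_ncard (M.subset_closure _ hQE) (M.ground_finite.subset hPE)
        omega
      have hfin : ({x ∈ M.E \ P | (M.closure (insert x P)).ncard = f}).Finite :=
        M.ground_finite.subset (maxExt_subset_ground _ f)
      have hfib : (s.bipartiteBelow r (x, y)).card ≤ ({x ∈ M.E \ P | (M.closure (insert x P)).ncard = f}).ncard := by
        rw [Set.ncard_eq_toFinset_card _ hfin]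
        refine (Finset.card_le_card (?_ : _ ⊆ hfin.toFinset.image (fun z => ({x, y} : Set α) ∪ {z}))).trans
          Finset.card_image_le
        intro B' hB'
        obtain ⟨z, hzx, hzy, hB'eq, hunion⟩ := hfibre B' hB'
        rw [Finset.mem_bipartiteBelow] at hB'
        obtain ⟨⟨⟨hB'E, -⟩, -, hr, hcl⟩, -⟩ := And.imp_left mem_extMax.1 hB'
        rw [Finset.mem_image]
        refine ⟨z, ?_, hB'eq.symm⟩
        rw [Set.Finite.mem_toFinset, mem_maxExt]
        have hzE : z ∈ M.E := hB'E (by rw [hB'eq]; exact Or.inr rfl)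
        have hzP : z ∉ P := by
          intro hzP
          rw [hunion, eRk_insert_eq_of_mem_closure hzP, hQr] at hr
          norm_num at hr
        refine ⟨hzE, hzP, ?_⟩
        rw [hPdef, M.closure_insert_closure_eq_closure_insert, ← hunion]
        exact hcl
      by_cases hPG : M.closure (insert y (insert x C)) = G
      · rw [if_pos hPG]
        refine hfib.trans ?_
        rw [hPdef, hPG]
        omega
      · rw [if_neg hPG, add_zero]
        exact hfib.trans (he P hPE hPflat hPr hP5 hPG)
    · have : s.bipartiteBelow r (x, y) = ∅ := by
        rw [Finset.eq_empty_iff_forall_notMem]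
        intro B' hB'
        obtain ⟨z, -, -, -, hunion⟩ := hfibre B' hB'
        rw [Finset.mem_bipartiteBelow] at hB'
        obtain ⟨⟨-, -, hr, -⟩, -⟩ := And.imp_left mem_extMax.1 hB'
        rw [hunion] at hr
        have h1 : M.eRk (insert z Q) ≤ M.eRk Q + 1 := M.eRk_insert_le_add_one _ _
        have h2 : M.eRk Q ≤ M.eRk C + 1 + 1 := by
          rw [hQdef]
          exact (M.eRk_insert_le_add_one _ _).trans (add_le_add (M.eRk_insert_le_add_one _ _) le_rfl)
        rw [hCr] at h2
        rw [hr] at h1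
        obtain ⟨q, hq⟩ := ENat.ne_top_iff_exists.1 (eRk_ne_top_of_finite hQE)
        rw [← hq] at h1 h2 hQr
        norm_cast at h1 h2 hQr
        omega
      rw [this, Finset.card_empty]
      exact Nat.zero_le _
  have hGcount : (t.filter (fun xy => M.closure (insert xy.2 (insert xy.1 C)) = G)).card ≤ G.ncard * G.ncard - G.ncard := by
    rw [Set.ncard_eq_toFinset_card _ hGfin, ← Finset.offDiag_card]
    refine Finset.card_le_card ?_
    rintro ⟨x, y⟩ hxy
    rw [Finset.mem_filter, htdef, Finset.mem_offDiag] at hxy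
    obtain ⟨⟨hx, hy, hne⟩, hcl⟩ := hxy
    rw [Finset.mem_offDiag]
    simp only at hcl hne ⊢
    have hxE : x ∈ M.E := ((hmemt x).1 hx).1
    have hyE : y ∈ M.E := ((hmemt y).1 hy).1
    refine ⟨?_, ?_, hne⟩
    · rw [Set.Finite.mem_toFinset, ← hcl]
      exact M.mem_closure_of_mem' (Set.mem_insert_of_mem y (Set.mem_insert x C)) hxE
    · rw [Set.Finite.mem_toFinset, ← hcl]
      exact M.mem_closure_of_mem' (Set.mem_insert y _) hyE
  calc s.card * 6 = ∑ B' ∈ s, (t.bipartiteAbove r B').card := hleft.symm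
    _ = ∑ xy ∈ t, (s.bipartiteBelow r xy).card := hsum
    _ ≤ ∑ xy ∈ t, (e + (if M.closure (insert xy.2 (insert xy.1 C)) = G then E - e else 0)) := Finset.sum_le_sum hright
    _ = t.card * e + (t.filter (fun xy => M.closure (insert xy.2 (insert xy.1 C)) = G)).card * (E - e) := by
        rw [Finset.sum_add_distrib, Finset.sum_const, smul_eq_mul, Finset.sum_ite, Finset.sum_const_zero, add_zero,
          Finset.sum_const, smul_eq_mul]
    _ ≤ _ := by
        rw [htdef, Finset.offDiag_card, ← Set.ncard_eq_toFinset_card _ hECfin]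
        exact add_le_add le_rfl (Nat.mul_le_mul_right _ hGcount)

end S2

end PercRepro
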